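import Summits.ABC.IUTFork.Joshi.ATS4MainBoundsThetaTower
import Summits.ABC.IUTFork.LDHSUnitFamilyPoint
import Literature.NumberTheory.NumberFields.RelativeDifferentExponentsTower
import Literature.IUT.LogVolume.DifferentOrdGaloisFibre
import Literature.IUT.LogVolume.DistinguishedPrimesBoundGalois
import Literature.IUT.LogVolume.CompletionLocalFields
import HarnessLib

/-!
# [J-IV] (arXiv:2403.10430v2) §6.10–§6.11 at GENUINE components: the two fibre sums at the prime `5` over the
# S-unit points `P_{a,c}` of the `λ`-line — `q₅ = a·log 5` exactly, `d₅ ≤ 2·log 5` on the whole `ℓ`-division tower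

Proof-only companion (0 defs) of the abc-iut cell, sub-cell R-J «JOSHI Y-DISCHARGE CENSUS» (rung LADDER-ABC:A2.RESCUE.J), row
Y-21 PARENT, kernel hand «residualSupport_unsat» (E-plan 21:34:34Z / 21:55:31Z / 22:07:05Z; E-cx-3's located countermodel, memo
`plan/E/cx-3/Y21-PARENT-READ.md` §C2–C3, E-cx-2's window-free form), seat abc-iut-E-t35 (gen 9; lineage p456387 `degF_*_eq_sum_fibers`).
This file supplies the GENUINE ARITHMETIC that E-t50's `not_exists_volumes_of_localExcess` (p470440) leaves open, at the prime `p₀ = 5`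
over the tree's S-unit quadratic family `SUnitFamily.Pt a c = (ℚ(√(5^{2a}+4·7^{2c})), θ/7^c)` (abc-iut-s2-p4, `LDHSUnitFamily*.lean`:
poles of `j(λ)` are `2a·𝔭₁ + 2c·𝔮₁ + 2c·𝔮₂`, `5` SPLIT in `F_{a,c}`):

* `multiplicity_differentIdeal_int_eq_add_mul` — per-place transitivity of the different along `ℤ ⊆ 𝓞F ⊆ 𝓞K`:
  `ord_u 𝔇_{K/ℤ} = ord_u 𝔇_{K/F} + e(u|w)·ord_w 𝔇_{F/ℤ}` (Mathlib `differentIdeal_eq_differentIdeal_mul_differentIdeal`,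
  `Ideal.IsDedekindDomain.emultiplicity_map_eq_ramificationIdx'_mul`);
* `SUnitResidual.dFive_le` — on the genuine tower `F_{a,c} ⊆ F` (theta field: `[F:F_{a,c}] ∣ 2¹⁰·3²·5`, Galois) `⊆ K` (Galois over `F`
  inside `F(E_F[ℓ])`, `ℓ ≠ 5`: TAME above `5` by the tree's `hKtame` = [IUTchIV] Prop. 1.8 (vii)) the genuine `5`-component of
  `log(d_{L′})` is `≤ 2·log 5` — for EVERY `ℓ ≠ 5` and every bookkeeping set `D_K`: the supplier cannot inflate `F` or `K` to
  absorb a local excess into `d₅` (E-cx-3's self-adversary question (c), answered NO);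
* `SUnitResidual.qFive_eq` — the genuine `5`-component of `log(q)` over any `M ⊇ F_{a,c}` and any `S = {2, ℓ}`, `ℓ ≥ 7`, is EXACTLY
  `a·log 5` (pull-back of the Tate divisor, `Σ_{w|𝔭₁} e_{w}f_{w} = [M:F_{a,c}]`); `exists_mem_V_residueChar_eq_five` — `Supp(𝔮_M)` has a
  place of residue characteristic `5`, so `5 ∈ V^dst_ℚ` under the support binder of `abc_of_genuineResidualSupport`.

SOURCE locators: [J-IV] Prop. 6.10.9 p.69 l.1–28 ([IUTchIV] Step (v) per `v_ℚ ∈ V^dst_ℚ`), (6.11.1) p.69 l.73–p.70 l.3, p.70 l.4–29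
(component sums); [IUTchIV] Prop. 1.3 p.12, Prop. 1.8 (vii) p.19, Thm. 1.10 Step (ii) p.24 (render `HOME/lit/renders/Joshi-arxiv-2403.10430/`,
kurims `book:anonnd-inter-universal-teichmuller-theory-iv`). FRAMING (binding): classical Dedekind theory composed with the tree's
PROVED tameness of the division tower; NO side taken on [IUTchIII] Cor. 3.12 / [IUTchIV] Thm. 1.10, on Joshi's claims or on Mochizuki's
report; NOT an abc claim; typed ≠ proved ≠ endorsed. Theorems only; standard axioms. [claim: Joshi2024ATS4, status: disputed] (locators).
-/

noncomputable section

namespace Summit.ABC.IUTFork.Joshi.ATS4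

open NumberField IsDedekindDomain Finset
open Literature.IUT.LogVolume Literature.IUT.LogVolume.Cor22
open Literature.NumberTheory.DiophantineGeometry.GenEll
open Literature.NumberTheory.NumberFields
open scoped Classical

/-! ## 1. Per-place transitivity of the different along `ℤ ⊆ 𝓞F ⊆ 𝓞K` -/

section Tower

variable (F K : Type*) [Field F] [NumberField F] [Field K] [NumberField K] [Algebra F K]

/-- `ord_u(I·𝓞K) = e(u|w)·ord_w(I)` for a nonzero ideal `I` of `𝓞F` and `w = u ∩ 𝓞F` (Mathlib's
`emultiplicity_map_eq_ramificationIdx'_mul`, finite multiplicities). [cite: NeukirchANT1999, Ch. I §8] -/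
theorem multiplicity_map_eq_ramificationIdx_mul (u : HeightOneSpectrum (𝓞 K)) {I : Ideal (𝓞 F)} (hI : I ≠ ⊥) :
    multiplicity u.asIdeal (I.map (algebraMap (𝓞 F) (𝓞 K))) =
      u.asIdeal.ramificationIdx (𝓞 F) * multiplicity (finBelow F K u).asIdeal I := by
  haveI : u.asIdeal.IsPrime := u.isPrime
  have hIK : I.map (algebraMap (𝓞 F) (𝓞 K)) ≠ ⊥ := Ideal.map_ne_bot_of_ne_bot hI
  have hfu := FiniteMultiplicity.of_prime_left (Ideal.prime_of_isPrime u.ne_bot u.isPrime) hIK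
  have hfw := FiniteMultiplicity.of_prime_left
    (Ideal.prime_of_isPrime (finBelow F K u).ne_bot (finBelow F K u).isPrime) hI
  have h := Ideal.IsDedekindDomain.emultiplicity_map_eq_ramificationIdx'_mul (S := 𝓞 K) hI
    (finBelow F K u).irreducible u.irreducible u.ne_bot (w := u.asIdeal) (v := (finBelow F K u).asIdeal)
  rw [hfu.emultiplicity_eq_multiplicity, hfw.emultiplicity_eq_multiplicity,
    Ideal.ramificationIdx'_eq_ramificationIdx (p := (finBelow F K u).asIdeal) (q := u.asIdeal) (finBelow F K u).ne_bot] at h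
  exact_mod_cast h

/-- **`ord_u 𝔇_{K/ℤ} = ord_u 𝔇_{K/F} + e(u|w)·ord_w 𝔇_{F/ℤ}`** (`w = u ∩ 𝓞F`): the transitivity of the different
`𝔇_{K/ℤ} = 𝔇_{K/F}·𝔇_{F/ℤ}𝓞K` read at one place. [cite: NeukirchANT1999, Ch. III (2.6)] -/
theorem multiplicity_differentIdeal_int_eq_add_mul (u : HeightOneSpectrum (𝓞 K)) :
    multiplicity u.asIdeal (differentIdeal ℤ (𝓞 K)) =
      multiplicity u.asIdeal (differentIdeal (𝓞 F) (𝓞 K)) +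
        u.asIdeal.ramificationIdx (𝓞 F) * multiplicity (finBelow F K u).asIdeal (differentIdeal ℤ (𝓞 F)) := by
  have hu := Ideal.prime_of_isPrime u.ne_bot u.isPrime
  rw [differentIdeal_eq_differentIdeal_mul_differentIdeal ℤ (𝓞 F) (𝓞 K),
    multiplicity_mul hu (FiniteMultiplicity.of_prime_left hu ?_),
    multiplicity_map_eq_ramificationIdx_mul F K u (differentIdeal_ne_bot' F)]
  exact mul_ne_zero differentIdeal_ne_bot (Ideal.map_ne_bot_of_ne_bot (differentIdeal_ne_bot' F))

end Tower

/-! ## 2. The genuine `5`-components over the S-unit points `P_{a,c}` -/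

namespace SUnitResidual

open Summit.ABC.IUTFork.SUnitFamily

variable {a c : ℕ} (ha : 1 ≤ a) (hc : 1 ≤ c)
include ha hc

/-- Every place of `F_{a,c}` over the SPLIT prime `5` is unramified over `ℚ`: `ord_v 𝔇_{F_{a,c}/ℤ} = 0` (`n_v = 1` by the tree's
`SplitDepth.localDegree_eq_one`, so `e(v|5) = 1 < 2`, Dedekind). [cite: NeukirchANT1999, Ch. III (2.6)] -/
theorem multiplicity_differentIdeal_F_eq_zero (v : HeightOneSpectrum (𝓞 (F a c))) (hv : v ∈ placesOver (F a c) 5) :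
    multiplicity v.asIdeal (differentIdeal ℤ (𝓞 (F a c))) = 0 := by
  haveI : Fact (Nat.Prime 5) := ⟨by norm_num⟩
  obtain ⟨𝔭₁, 𝔭₂, -, -, ⟨h1, -, h15, -⟩, ⟨h2, -, h25, -⟩, -, -⟩ := exists_four_places ha hc
  have hdeg := localDegree_pair_eq_one (p := 5) h1 h2 h15 h25
  have hone : localDegree (F a c) v = 1 := by
    rw [placesOver_eq_pair (p := 5) h1 h2 h15 h25, Finset.mem_insert, Finset.mem_singleton] at hv
    rcases hv with rfl | rfl
    · exact hdeg.1
    · exact hdeg.2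
  have hram : ramIdx (F a c) v = 1 := Nat.eq_one_of_mul_eq_one_right hone
  rw [ramIdx_eq] at hram
  exact multiplicity_absDifferent_eq_zero_of_ramificationIdx_eq_one v hram

omit ha hc in
/-- `v₅(2¹⁰·3²·5) = 1`. [folklore] -/
private theorem factorization_46080_five : (46080 : ℕ).factorization 5 = 1 := by
  have h : (46080 : ℕ) = 5 ^ 1 * 9216 := by norm_num
  rw [h, Nat.factorization_mul (by norm_num) (by norm_num), Finsupp.add_apply,
    (Nat.prime_five).factorization_pow, Finsupp.single_eq_same, Nat.factorization_eq_zero_of_not_dvd (by norm_num)]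

/-- **`d₅ ≤ 2·log 5` on the genuine tower over `P_{a,c}`.** For a theta field `F ⊇ F_{a,c}` and `K ⊇ F` Galois inside `F(E_F[ℓ])`
(via `ψ`), `ℓ` prime `≠ 5`, and ANY finite set `D_K` of places of `K`: the genuine `5`-component
`(1/[K:ℚ])·Σ_{u ∈ D_K, p_u = 5} ord_u(𝔡_K)·log N(u)` of `log(d_{L′})` is `≤ 2·log 5`. Per place `ord_u 𝔡_K + 1 ≤ 2·e(u|5)`:
`ord_u 𝔇_{K/ℤ} = ord_u 𝔇_{K/F_{a,c}}` (`F_{a,c}` unramified at the split prime `5`, `multiplicity_differentIdeal_int_eq_add_mul`), then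
the tree's `multiplicity_differentIdeal_tower_succ_le_of_not_dvd_top` (Dedekind–Hensel for the Galois layer `F/F_{a,c}`, `[F:F_{a,c}] ∣ 46080`,
`v₅(46080) = 1`; tame top layer `K/F` above `5 ≠ ℓ` by the tree's `ThetaTower.hKtame`); finally `Σ_{u|5} e_u f_u = [K:ℚ]`. [cite: Mochizuki2012, IUTchIV Prop. 1.3 p. 12] -/
theorem dFive_le {F : Type} [Field F] [NumberField F] [Algebra (Pt a c).F F] {K : Type} [Field K] [NumberField K]
    [Algebra F K] [Algebra (Pt a c).F K] [IsScalarTower (Pt a c).F F K] (ψ : K →ₐ[F] AlgebraicClosure F) (hU : (Pt a c).InU) (hF : IsThetaField (Pt a c) F) [IsGalois F K]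
    {ℓ : ℕ} (hℓ : ℓ.Prime) (hℓ5 : ℓ ≠ 5)
    (hK : letI := thetaCurve_isElliptic hU F
      ((thetaCurve (Pt a c) F).galoisRepTorsion (ℓ : ℤ)).ker ≤ ψ.fieldRange.fixingSubgroup)
    (DK : Finset (HeightOneSpectrum (𝓞 K))) :
    (Module.finrank ℚ K : ℝ)⁻¹ * ∑ u ∈ DK with residueChar K u = 5, differentDivisor K (Sum.inr u) * logNorm K u ≤
      2 * Real.log 5 := by
  haveI : Fact (Nat.Prime 5) := ⟨by norm_num⟩
  haveI : IsGalois (Pt a c).F F := hF.isGalois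
  have hKpos : (0 : ℝ) < Module.finrank ℚ K := by exact_mod_cast Module.finrank_pos
  -- per place over `5`: `ord_u 𝔡_K + 1 ≤ 2·e(u|5)`
  have hper : ∀ u ∈ placesOver K 5, multiplicity u.asIdeal (differentIdeal ℤ (𝓞 K)) + 1 ≤ 2 * ramIdx K u := by
    intro u hu
    have hres : residueChar K u = 5 := (mem_placesOver_iff_residueChar u).mp hu
    haveI : u.asIdeal.IsMaximal := u.isMaximal
    haveI : (finBelow F K u).asIdeal.IsMaximal := (finBelow F K u).isMaximal
    rw [ramIdx_eq, multiplicity_differentIdeal_int_eq_add_mul (Pt a c).F K u,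
      multiplicity_differentIdeal_F_eq_zero ha hc _ ((mem_placesOver_iff_residueChar _).mpr (by
        rw [residueChar_finBelow, hres])), mul_zero, add_zero]
    -- `F_{a,c} → F → K`: Dedekind–Hensel for the Galois layer, tame top layer above `5 ≠ ℓ` (the tree's `hKtame`)
    have htame := ThetaTower.hKtame ψ hU hF hℓ hK u (by rw [hres]; exact hℓ5.symm)
    have h := multiplicity_differentIdeal_tower_succ_le_of_not_dvd_top (Pt a c).F F K u.asIdeal (M := 46080)
      (by norm_num) (by have := ThetaTower.hdvd hF; norm_num at this; exact this) htame
    have hres' : Ideal.absNorm (u.asIdeal.under ℤ) = 5 := hres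
    rw [hres', factorization_46080_five] at h
    linarith
  -- sum over `D_K ∩ {p_u = 5} ⊆ V(K)_5`
  have hsub : DK.filter (fun u => residueChar K u = 5) ⊆ placesOver K 5 := fun u hu =>
    (mem_placesOver_iff_residueChar u).mpr (Finset.mem_filter.mp hu).2
  have hle := Finset.sum_le_sum_of_subset_of_nonneg hsub
    (f := fun u => differentDivisor K (Sum.inr u) * logNorm K u) (fun u _ _ => differentDivisor_mul_logNorm_nonneg K u)
  have hterm : ∀ u ∈ placesOver K 5, differentDivisor K (Sum.inr u) * logNorm K u ≤ 2 * Real.log 5 * localDegree K u := by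
    intro u hu
    have hres : residueChar K u = 5 := (mem_placesOver_iff_residueChar u).mp hu
    rw [differentDivisor_apply_inr, logNorm_eq, hres, localDegree]
    have h := hper u hu
    have h' : (multiplicity u.asIdeal (differentIdeal ℤ (𝓞 K)) : ℝ) ≤ 2 * ramIdx K u := by exact_mod_cast (by omega)
    have hf : (0 : ℝ) ≤ resDeg K u := Nat.cast_nonneg _
    have hl : (0 : ℝ) ≤ Real.log 5 := Real.log_nonneg (by norm_num)
    push_cast
    nlinarith [mul_nonneg hf hl]
  have hsum : ∑ u ∈ placesOver K 5, differentDivisor K (Sum.inr u) * logNorm K u ≤ 2 * Real.log 5 * Module.finrank ℚ K := by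
    refine (Finset.sum_le_sum hterm).trans ?_
    rw [← Finset.mul_sum, ← Nat.cast_sum, sum_localDegree K 5]
  rw [inv_mul_le_iff₀ hKpos]
  linarith

/-- The pole `𝔭₁ ∣ 5` of `j(λ_{a,c})` lies in `Supp(𝔮_{F_{a,c}})` away from `S = {2, ℓ}` for every prime `ℓ ≥ 7` (`p_{𝔭₁} = 5 ∉ {2, ℓ}`).
[cite: Mochizuki2012, IUTchIV Cor 2.2 (ii) proof (P5) p.46] -/
theorem pole_mem_ofNFPoint_V {ℓ : ℕ} (hℓ : ℓ.Prime) (h7 : 7 ≤ ℓ) {𝔭₁ : HeightOneSpectrum (𝓞 (F a c))}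
    (h1 : θI a c ∈ 𝔭₁.asIdeal) (h1' : θI' a c ∉ 𝔭₁.asIdeal) (h15 : ((5 : ℕ) : 𝓞 (F a c)) ∈ 𝔭₁.asIdeal)
    (ho1 : ord (F a c) 𝔭₁ (5 : F a c) = 1) : 𝔭₁ ∈ (TateDivisorDatum.ofNFPoint (Pt a c) {2, ℓ}).V := by
  haveI : Fact (Nat.Prime 5) := ⟨by norm_num⟩
  have hres1 : residueChar (F a c) 𝔭₁ = 5 := (mem_placesOver_iff_residueChar 𝔭₁).mp (mem_placesOver_of_natCast_mem 5 𝔭₁ h15)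
  have hord1 : ord (F a c) 𝔭₁ (jInv (lam a c)) = -(2 * (a : ℤ)) := (ord_at_p1 hc h15 h1 h1' ho1).1
  rw [TateDivisorDatum.mem_ofNFPoint_V]
  refine ⟨(mem_badPlaces_iff_ord_neg (Pt a c) 𝔭₁).mpr (by change ord (F a c) 𝔭₁ (jInv (lam a c)) < 0; omega), fun p hp => ?_⟩
  have hp' : p = 2 ∨ p = ℓ := by simpa using hp
  rw [natCast_mem_asIdeal_iff_residueChar_eq 𝔭₁ (by rcases hp' with rfl | rfl; exacts [Nat.prime_two, hℓ])]
  change residueChar (F a c) 𝔭₁ ≠ p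
  omega

/-- Over any finite `M ⊇ F_{a,c}`, `Supp(𝔮_M)` (away from `{2, ℓ}`, `ℓ ≥ 7`) contains a place of residue characteristic `5` — so `5` lies in every
`V^dst_ℚ` containing the residue characteristics of `Supp(𝔮_M)` (the binder `hbad` of `abc_of_genuineResidualSupport`).
[cite: Mochizuki2012, IUTchIV Thm. 1.10 p. 23] -/
theorem exists_mem_V_residueChar_eq_five {ℓ : ℕ} (hℓ : ℓ.Prime) (h7 : 7 ≤ ℓ) (M : Type) [Field M] [NumberField M]
    [Algebra (Pt a c).F M] : ∃ w ∈ (TateDivisorDatum.ofNFPointOver (Pt a c) {2, ℓ} M).V, residueChar M w = 5 := by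
  haveI : Fact (Nat.Prime 5) := ⟨by norm_num⟩
  obtain ⟨𝔭₁, -, -, -, ⟨h1, h1', h15, ho1⟩, -, -, -⟩ := exists_four_places ha hc
  obtain ⟨w, hw⟩ := PlaceSection.exists_under_eq (K := M) 𝔭₁
  have hfb : finBelow (F a c) M w = 𝔭₁ := (HeightOneSpectrum.ext rfl).trans hw
  refine ⟨w, (TateDivisorDatum.mem_ofNFPointOver_V_iff (Pt a c) {2, ℓ} M w).mpr ?_, ?_⟩
  · change finBelow (F a c) M w ∈ _
    rw [hfb]; exact pole_mem_ofNFPoint_V ha hc hℓ h7 h1 h1' h15 ho1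
  · rw [← residueChar_finBelow (F := F a c), hfb]
    exact (mem_placesOver_iff_residueChar 𝔭₁).mp (mem_placesOver_of_natCast_mem 5 𝔭₁ h15)

/-- **`q₅ = a·log 5` EXACTLY** over every finite `M ⊇ F_{a,c}` and every `S = {2, ℓ}`, `ℓ ≥ 7`: the genuine `5`-component
`(1/[M:ℚ])·Σ_{w ∈ Supp 𝔮_M, p_w = 5} ord_w(q_w)·log N(w)` of `log(q)` — the places of `M` over `5` in `Supp(𝔮_M)` are exactly those over the
pole `𝔭₁` (`𝔭₂ ∣ 5` is good), `ord_w(q_w) = e(w|𝔭₁)·2a` (pull-back, [J-IV] (4.4.6) / `Cor22.localHeight_of_algebraMap`), and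
`Σ_{w|𝔭₁} e(w|𝔭₁)·log N(w) = [M:F_{a,c}]·log 5`. [cite: Mochizuki2012, IUTchIV Def. 1.9 (i) p. 22] -/
theorem qFive_eq {ℓ : ℕ} (hℓ : ℓ.Prime) (h7 : 7 ≤ ℓ) (M : Type) [Field M] [NumberField M] [Algebra (Pt a c).F M] :
    (Module.finrank ℚ M : ℝ)⁻¹ *
      ∑ w ∈ (TateDivisorDatum.ofNFPointOver (Pt a c) {2, ℓ} M).V with residueChar M w = 5,
        (TateDivisorDatum.ofNFPointOver (Pt a c) {2, ℓ} M).tateDivisor (Sum.inr w) * logNorm M w = a * Real.log 5 := by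
  haveI : Fact (Nat.Prime 5) := ⟨by norm_num⟩
  obtain ⟨𝔭₁, 𝔭₂, -, -, ⟨h1, h1', h15, ho1⟩, ⟨h2, -, h25, -⟩, -, -⟩ := exists_four_places ha hc
  set 𝔮M := TateDivisorDatum.ofNFPointOver (Pt a c) {2, ℓ} M with h𝔮M
  have hp1over : 𝔭₁ ∈ placesOver (F a c) 5 := mem_placesOver_of_natCast_mem 5 𝔭₁ h15
  have hord1 : ord (F a c) 𝔭₁ (jInv (lam a c)) = -(2 * (a : ℤ)) := (ord_at_p1 hc h15 h1 h1' ho1).1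
  have hbad1 : 𝔭₁ ∈ badPlaces (Pt a c) := (mem_badPlaces_iff_ord_neg (Pt a c) 𝔭₁).mpr (by
    change ord (F a c) 𝔭₁ (jInv (lam a c)) < 0; omega)
  have hV1 : 𝔭₁ ∈ (TateDivisorDatum.ofNFPoint (Pt a c) {2, ℓ}).V := pole_mem_ofNFPoint_V ha hc hℓ h7 h1 h1' h15 ho1
  -- Step 1: the index set is the fibre of `𝔭₁`
  have hset : 𝔮M.V.filter (fun w => residueChar M w = 5) = (placesOver M 5).filter (fun w => finBelow (F a c) M w = 𝔭₁) := by
    ext w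
    rw [Finset.mem_filter, Finset.mem_filter, mem_placesOver_iff_residueChar, h𝔮M, TateDivisorDatum.mem_ofNFPointOver_V_iff]
    constructor
    · rintro ⟨hw, hres⟩
      refine ⟨hres, ?_⟩
      have hv := ((TateDivisorDatum.mem_ofNFPoint_V (Pt a c) {2, ℓ} _).mp hw).1
      have hv5 : finBelow (F a c) M w ∈ placesOver (F a c) 5 := by
        rw [mem_placesOver_iff_residueChar, residueChar_finBelow, hres]
      rw [placesOver_eq_pair (p := 5) h1 h2 h15 h25, Finset.mem_insert, Finset.mem_singleton] at hv5
      rcases hv5 with h | h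
      · exact h
      · exfalso
        have hneg := (mem_badPlaces_iff_ord_neg (Pt a c) _).mp hv
        change ord (F a c) (finBelow (F a c) M w) (jInv (lam a c)) < 0 at hneg
        rw [h] at hneg
        exact absurd (ord_at_p2 hc h25 h2).1 (not_le.mpr hneg)
    · rintro ⟨hres, hw⟩
      refine ⟨?_, hres⟩
      change finBelow (F a c) M w ∈ _
      rw [hw]; exact hV1
  -- Step 2: the summand on the fibre of `𝔭₁`
  have hloc1 : localHeight (Pt a c) 𝔭₁ = 2 * a := by
    rw [localHeight_eq_neg_ord hbad1]
    change -((ord (F a c) 𝔭₁ (jInv (lam a c)) : ℤ) : ℝ) = _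
    rw [hord1]; push_cast; ring
  have hterm : ∀ w ∈ (placesOver M 5).filter (fun w => finBelow (F a c) M w = 𝔭₁),
      𝔮M.tateDivisor (Sum.inr w) * logNorm M w =
        2 * a * ((pullbackWeight (F a c) M (Sum.inr w) : ℝ) * degWeight M (Sum.inr w)) := by
    intro w hw
    have hw1 : finBelow (F a c) M w = 𝔭₁ := (Finset.mem_filter.mp hw).2
    have hwV : w ∈ 𝔮M.V := by
      have : w ∈ 𝔮M.V.filter (fun w => residueChar M w = 5) := by rw [hset]; exact hw
      exact (Finset.mem_filter.mp this).1
    rw [𝔮M.tateDivisor_apply_inr, if_pos hwV, h𝔮M]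
    letI : Algebra (Pt a c).F (extend (Pt a c) M).F := ‹Algebra (Pt a c).F M›
    rw [TateDivisorDatum.ordq_ofNFPoint_cast, localHeight_of_algebraMap (P := Pt a c) (Q := extend (Pt a c) M) rfl w]
    change ((finBelow (F a c) M w).asIdeal.ramificationIdx' w.asIdeal : ℝ) * localHeight (Pt a c) (finBelow (F a c) M w) *
      logNorm M w = 2 * a * (((finBelow (F a c) M w).asIdeal.ramificationIdx' w.asIdeal : ℝ) * logNorm M w)
    rw [hw1, hloc1]; ring
  -- Step 3: the fibre identity `Σ_{w|𝔭₁} e(w|𝔭₁)·log N(w) = [M:F_{a,c}]·log 5`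
  have hlog1 : logNorm (F a c) 𝔭₁ = Real.log 5 := (weight_pair_eq_half (p := 5) h1 h2 h15 h25).1.2
  have hfib : ∑ w ∈ (placesOver M 5).filter (fun w => finBelow (F a c) M w = 𝔭₁),
      ((pullbackWeight (F a c) M (Sum.inr w) : ℝ) * degWeight M (Sum.inr w)) = Module.finrank (F a c) M * Real.log 5 := by
    have h := sum_pullbackWeight_mul_degWeight_inr (F := F a c) (K := M) 𝔭₁
    rw [← filter_finBelow_eq_placesAbove (F a c) M 𝔭₁ hp1over, Finset.sum_map, degWeight_inr, hlog1] at h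
    exact h
  rw [hset, Finset.sum_congr rfl hterm, ← Finset.mul_sum, hfib,
    finrank_rat_eq_mul (F := F a c) (K := M), finrank_F a c]
  have hMpos : (0 : ℝ) < Module.finrank (F a c) M := by exact_mod_cast Module.finrank_pos
  field_simp
  ring

end SUnitResidual

end Summit.ABC.IUTFork.Joshi.ATS4

end
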